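import Literature.MathematicalPhysics.QuantumFieldTheory.Balaban1983to89.B9Cor35GpDirInputsAtOne
import Literature.MathematicalPhysics.QuantumFieldTheory.Balaban1983to89.B9Ineq346SecondOrderTorusCutoff

/-!
# `Balaban1983to89.B9CubeSequence408MirrorsStencil` — [Balaban1985BackgroundPropagators] p. 408, THE COLLARS OF THE CUBE SEQUENCE: «dist(Ω_n(□)ᶜ, Ω_{n+1}(□))
# = 2R₀M₀Lⁿη» READ FOR THE DIRICHLET DOMAIN `Ω₀(□)` OF ROAD P4 — every site within two lattice steps of `C₁(□) ⊇ {lev_□ ≥ 1}` lies in `Ω₀(□)`; in particular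
# the 2-step stencil of every row of positive cube level lies in `Ω₀(□)` (the displayed geometry `hS2` of UNITS 7–10 of this seat, DISCHARGED) — sub-row
# G-B9-LETTERS (site sector), seat dag-n06-c g32 UNIT 11

statement-level skeleton of published theorems with citation tags; proofs where landed; nothing here is a claim about the Yang–Mills mass gap

CITATION HEADER (lean-in-tree rule).  B9 = T. Bałaban, *Propagators for lattice gauge theories in a background field*, Commun. Math. Phys. **99** (1985)
389–434 [Balaban1985BackgroundPropagators] (held `paper:balaban1985-cmp99-background-propagators`; journal page = PDF page + 388): p. 408 (last lines) –
p. 409 l. 1 («For n < j we have Ω_n(□) ⊃ Ω_{n+1}(□) and dist(Ω_n(□)ᶜ, Ω_{n+1}(□)) = 2R₀M₀Lⁿη … hence Ω₀(□) ⊂ □⁵»); p. 394 («Ω₀»); [Balaban1983RegularityDecay]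
(2.42) p. 584 (the method of images: the mirror box).  Rows B9.Cor3.6 × B9.p408-collars (cells only; no row head changes).

WHY THIS FILE (road P4 of the N06 h36b campaign).  g31's `B9CubeSequence408Mirrors` builds `Ω₀(□)` = the image of the open mirror box and proves
`C₁(□) ⊂ Ω₀(□)` (`mem_dirDomC_of_InC`) with ONE TOP BLOCK of margin inside the box (`window_sub_box`, `exists_preimage_coord`).  The estimate package of UNITS
7–10 (`B9Cor36GpDirExtAtField` … `B9Cor36GpDirAtMemberBlocks`) displays the hypothesis `hS2`: the 2-step lattice stencil of every site of positive cube level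
lies in `Ω₀(□)` (the cut potential's jumps and the flux across `∂Ω₀(□)` sit on level-`0` rows).  §1–§2 widen g31's preimage lemma from `C₁(□)` to the sites
within `m ≤ S_{k′} − 1` of `C₁(□)` (coordinatewise, torus distance), §3 reads it for the 2-step stencil (`m = 2 ≤ S_{k′} − 1`, `S_{k′} = M_hL^{k′+1} ≥ 3`).

WHAT IS PROVED (0 `def`s; 0 sorry; 0 new named facts; standard axioms): `circAbs_add_le` (§1), `exists_preimage_coord_wide`, ★`mem_dirDomC_of_near_InC` (§2),
`circAbs_twrap_add_sub_le`, `three_le_sTop`, ★★`stencil2_mem_dirDomC`, ★★`hS2_dirDomY` (§3–§4: the displayed `hS2` of UNITS 7–10, verbatim, as a theorem);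
v1.1 §5 `nMir_le`, ★`circAbs_le_of_mem_dirDomC` (the extent of `Ω₀(□)`: half-width `w₁ + 3S_{k′} + 1` in a mirrored direction — the box a (3.35) datum must cover),
`N0_lt_of_not_mirC`, ★`hQ_of_box` (the datum-box interface: a box-shaped datum set `Q` of that half-width gives the hypothesis `hQ` of UNITS 7–12).
-/

namespace Literature.MathematicalPhysics.QuantumFieldTheory.Balaban1983to89.B9CubeSequence408MirrorsStencil

noncomputable section

open Finset Matrix
open Literature.MathematicalPhysics.QuantumFieldTheory.Balaban1983to89.B4Reflection242 (boxDom mem_boxDom blk)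
open Literature.MathematicalPhysics.QuantumFieldTheory.Balaban1983to89.B4TorusKernel.MultiPeriod (torusSupNorm circAbs centre abs_add_mul_centre circAbs_nonneg
  circAbs_add_mul circAbs_le_abs)
open Literature.MathematicalPhysics.QuantumFieldTheory.Balaban1983to89.B6MultiLevelBoxOperator (N0 bigSide one_le_bigSide)
open Literature.MathematicalPhysics.QuantumFieldTheory.Balaban1983to89.B6MultiLevelTorusOperator (twrap tshift one_le_N0 tshift_val tshift_symm_apply unitVec)
open Literature.MathematicalPhysics.QuantumFieldTheory.Balaban1983to89.B6MultiLevelTorusOperatorL0 (TDomains)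
open Literature.MathematicalPhysics.QuantumFieldTheory.Balaban1983to89.B6Cover236MultiLevelBlocks (cubes)
open Literature.MathematicalPhysics.QuantumFieldTheory.Balaban1983to89.B9CubeSequence408 (sI hf wid collar ctrC InC cubeFam lev_cubeFam_eq_zero)
open Literature.MathematicalPhysics.QuantumFieldTheory.Balaban1983to89.B4Eq242TorusMirrors
open Literature.MathematicalPhysics.QuantumFieldTheory.Balaban1983to89.B6MultiLevelTorusMirrorL0
open Literature.MathematicalPhysics.QuantumFieldTheory.Balaban1983to89.B9CubeSequence408Mirrors (kTop kTop_le one_le_kTop mirC mC gC two_le_mC boxC dirDomC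
  mem_dirDomC_iff gC_window window_le_nMir)
open Literature.MathematicalPhysics.QuantumFieldTheory.Balaban1983to89.B6KLevelCensusIndexV1 (KIdx)
open Literature.MathematicalPhysics.QuantumFieldTheory.Balaban1983to89.B9CubeLettersOpsL0 (oddMh levCubeY)
open Literature.MathematicalPhysics.QuantumFieldTheory.Balaban1983to89.B9Cor35GpDirInputsAtOne (dirDomY)
open Literature.MathematicalPhysics.QuantumFieldTheory.Balaban1983to89.Node00 (SiteY toKT shiftY)

variable {d : ℕ}

/-! ## §1  Torus distances move by at most `|b|` under a translation by `b` -/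

section Circ

/-- `circAbs_N(a + b) ≤ circAbs_N(a) + |b|`. [cite: Balaban1983RegularityDecay, p.572 («periodic conditions»), bookkeeping] -/
theorem circAbs_add_le {N : ℕ} (hN : 1 ≤ N) (a b : ℤ) : circAbs N (a + b) ≤ circAbs N a + |b| := by
  calc circAbs N (a + b) = circAbs N ((a + N * centre N a + b) + N * (-centre N a)) := by congr 1; ring
    _ = circAbs N (a + N * centre N a + b) := circAbs_add_mul N _ _
    _ ≤ |a + N * centre N a + b| := circAbs_le_abs hN _
    _ ≤ |a + N * centre N a| + |b| := abs_add_le _ _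
    _ = circAbs N a + |b| := by rw [abs_add_mul_centre hN]

/-- a wrapped translate: `circAbs_N((z + v) mod N − a) ≤ circAbs_N(z − a) + |v|`. [cite: Balaban1983RegularityDecay, p.572, bookkeeping] -/
theorem circAbs_emod_add_sub_le {N : ℕ} (hN : 1 ≤ N) (z v a : ℤ) : circAbs N ((z + v) % (N : ℤ) - a) ≤ circAbs N (z - a) + |v| := by
  have e : (z + v) % (N : ℤ) - a = ((z - a) + v) + N * (-((z + v) / (N : ℤ))) := by rw [Int.emod_def]; ring
  rw [e, circAbs_add_mul]
  exact circAbs_add_le hN _ _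

end Circ

/-! ## §2  The preimage lemma widened: sites within `m ≤ S_{k′} − 1` of `C₁(□)` are images of open-box sites -/

section Wide

variable {ℓ Mh k R : ℕ} {P : Fin (d + 1) → ℕ} {D : B6MultiLevelTorusOperator.TDomains d ℓ Mh k P R}

/-- in a mirrored direction, a torus coordinate within `w₁ + m` of the centre (`m ≤ S_{k′} − 1`) is the image of an OPEN-box coordinate
`s′ = t + N₀r − g_μ ∈ [h + 1, h + n − 1]`. [cite: Balaban1985BackgroundPropagators, p.408 («dist(Ω₀(□)ᶜ, □⁴) < 2R₀M₀Lʲη»); Balaban1983RegularityDecay, (2.42) p.584] -/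
theorem exists_preimage_coord_wide (hMh : 1 ≤ Mh) (hP : ∀ μ, 1 ≤ P μ) {q : ↥(cubes D.toDomains)} {μ : Fin (d + 1)}
    (hμ : mirC q μ = true) {t m : ℤ} (hm : m + 1 ≤ sTop ℓ Mh (kTop q))
    (ht : circAbs (N0 ℓ Mh k P μ) (t - ctrC q μ) ≤ wid ℓ Mh R q.1.1 1 + m) :
    hMir ℓ Mh (kTop q) + 1 ≤ t + (N0 ℓ Mh k P μ : ℤ) * centre (N0 ℓ Mh k P μ) (t - ctrC q μ) - gC q μ ∧
      t + (N0 ℓ Mh k P μ : ℤ) * centre (N0 ℓ Mh k P μ) (t - ctrC q μ) - gC q μ ≤ hMir ℓ Mh (kTop q) + nMir ℓ Mh (kTop q) (mC q) μ - 1 ∧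
      (t + (N0 ℓ Mh k P μ : ℤ) * centre (N0 ℓ Mh k P μ) (t - ctrC q μ) - gC q μ + gC q μ) % (N0 ℓ Mh k P μ : ℤ) = t % (N0 ℓ Mh k P μ : ℤ) := by
  have hN := one_le_N0 (ℓ := ℓ) (k := k) hMh hP μ
  obtain ⟨hG1, hG2⟩ := gC_window (ℓ := ℓ) (R := R) hMh hμ
  have hn := window_le_nMir (ℓ := ℓ) (R := R) hMh q μ
  have habs : |t - ctrC q μ + (N0 ℓ Mh k P μ : ℤ) * centre (N0 ℓ Mh k P μ) (t - ctrC q μ)| ≤ wid ℓ Mh R q.1.1 1 + m := by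
    rw [abs_add_mul_centre hN]; exact ht
  obtain ⟨hlo, hhi⟩ := abs_le.1 habs
  refine ⟨by linarith, by linarith, ?_⟩
  rw [sub_add_cancel, Int.add_mul_emod_self_left]

/-- ★ **EVERY SITE WITHIN `m ≤ S_{k′} − 1` OF `C₁(□)` (coordinatewise torus distance) LIES IN `Ω₀(□)`** — g31's `mem_dirDomC_of_InC` with the margin of the
mirror box spent. [cite: Balaban1985BackgroundPropagators, p.408 («Ω₀(□) ⊃ Ω₁(□)», «dist(Ω_n(□)ᶜ, Ω_{n+1}(□)) = 2R₀M₀Lⁿη»); Balaban1983RegularityDecay, (2.42) p.584] -/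
theorem mem_dirDomC_of_near_InC (hL : Odd (ℓ + 1)) (hM : Odd Mh) (hMh : 1 ≤ Mh) (hP : ∀ μ, 1 ≤ P μ) (q : ↥(cubes D.toDomains))
    {z : ↥(boxDom (N0 ℓ Mh k P))} {m : ℤ} (hm : m + 1 ≤ sTop ℓ Mh (kTop q))
    (hz : ∀ μ, circAbs (N0 ℓ Mh k P μ) (z.1 μ - ctrC q μ) ≤ wid ℓ Mh R q.1.1 1 + m) : z ∈ dirDomC D q hMh hP := by
  rw [mem_dirDomC_iff]
  have hs := one_le_sTop (ℓ := ℓ) (k' := kTop q) hMh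
  have hh := two_mul_hMir_add_one (ℓ := ℓ) (k' := kTop q) hL hM
  set y : Fin (d + 1) → ℤ := fun μ => if mirC q μ = true then
      z.1 μ + (N0 ℓ Mh k P μ : ℤ) * centre (N0 ℓ Mh k P μ) (z.1 μ - ctrC q μ) - gC q μ else z.1 μ with hy
  have hymem : y ∈ boxDom (N0 ℓ Mh (kTop q) (Pref ℓ k (kTop q) P (mirC q) (mC q))) := by
    rw [mem_boxDom]; intro μ
    by_cases hμ : mirC q μ = true
    · obtain ⟨h1, h2, -⟩ := exists_preimage_coord_wide (ℓ := ℓ) (R := R) hMh hP hμ hm (hz μ)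
      have hN := N0_Pref_of_mir (ℓ := ℓ) (Mh := Mh) (k := k) (k' := kTop q) (P := P) (m := mC q) hμ
      have hnm : sTop ℓ Mh (kTop q) ≤ nMir ℓ Mh (kTop q) (mC q) μ := by
        have h2 := two_le_mC q μ hμ
        have h2' : (2 : ℤ) ≤ (mC q μ : ℤ) := by exact_mod_cast h2
        unfold nMir; nlinarith
      have hyμ : y μ = z.1 μ + (N0 ℓ Mh k P μ : ℤ) * centre (N0 ℓ Mh k P μ) (z.1 μ - ctrC q μ) - gC q μ := by rw [hy]; simp only [hμ, if_true]
      rw [hyμ]; constructor <;> linarith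
    · have hb := (mem_boxDom.1 z.2) μ
      have hyμ : y μ = z.1 μ := by rw [hy]; simp only [if_neg hμ]
      rw [hyμ, N0_Pref_of_not_mir (kTop_le q) hμ]; exact hb
  refine ⟨⟨y, hymem⟩, ?_, ?_⟩
  · simp only [boxC, mirBoxOpen, Finset.mem_filter, Finset.mem_univ, true_and]
    intro μ hμ
    obtain ⟨h1, h2, -⟩ := exists_preimage_coord_wide (ℓ := ℓ) (R := R) hMh hP hμ hm (hz μ)
    have hyμ : y μ = z.1 μ + (N0 ℓ Mh k P μ : ℤ) * centre (N0 ℓ Mh k P μ) (z.1 μ - ctrC q μ) - gC q μ := by rw [hy]; simp only [hμ, if_true]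
    simp only [hyμ]
    constructor <;> linarith
  · funext μ
    show (y μ + gC q μ) % (N0 ℓ Mh k P μ : ℤ) = z.1 μ
    have hb := (mem_boxDom.1 z.2) μ
    by_cases hμ : mirC q μ = true
    · obtain ⟨-, -, h3⟩ := exists_preimage_coord_wide (ℓ := ℓ) (R := R) hMh hP hμ hm (hz μ)
      have hyμ : y μ = z.1 μ + (N0 ℓ Mh k P μ : ℤ) * centre (N0 ℓ Mh k P μ) (z.1 μ - ctrC q μ) - gC q μ := by rw [hy]; simp only [hμ, if_true]
      rw [hyμ, h3]; exact Int.emod_eq_of_lt hb.1 hb.2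
    · have hyμ : y μ = z.1 μ := by rw [hy]; simp only [if_neg hμ]
      have hg : gC q μ = 0 := by unfold gC; rw [if_neg hμ]
      rw [hyμ, hg, add_zero]; exact Int.emod_eq_of_lt hb.1 hb.2

end Wide

/-! ## §3  The 2-step stencil of a positive-level row lies in `Ω₀(□)` -/

section Stencil

variable {ℓ Mh k R : ℕ} {P : Fin (d + 1) → ℕ} {D : B6MultiLevelTorusOperator.TDomains d ℓ Mh k P R}

/-- `S_{k′} = M_hL^{k′+1} ≥ 3` (`L ≥ 3` odd, `M_h ≥ 1`). [cite: Balaban1984PropagatorsII, (2.1) p.224, bookkeeping] -/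
theorem three_le_sTop (hL : Odd (ℓ + 1) ∧ 1 < ℓ + 1) (hMh : 1 ≤ Mh) (k' : ℕ) : 3 ≤ sTop ℓ Mh k' := by
  have hL3 : 3 ≤ ℓ + 1 := by
    obtain ⟨r, hr⟩ := hL.1
    omega
  have h1 : 3 ≤ (ℓ + 1) ^ (k' + 1) := le_trans hL3 (Nat.le_self_pow (Nat.succ_ne_zero k') (ℓ + 1))
  have h2 : 3 ≤ Mh * (ℓ + 1) ^ (k' + 1) := le_trans h1 (Nat.le_mul_of_pos_left _ hMh)
  show (3 : ℤ) ≤ ((Mh * (ℓ + 1) ^ (k' + 1) : ℕ) : ℤ)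
  exact_mod_cast h2

/-- the coordinates of a translate `(z + v) mod N₀` are within `|v|` of those of `z`, in torus distance to any centre. [cite: Balaban1983RegularityDecay, p.572, bookkeeping] -/
theorem circAbs_twrap_add_sub_le (hMh : 1 ≤ Mh) (hP : ∀ μ, 1 ≤ P μ) (z v a : Fin (d + 1) → ℤ) (μ : Fin (d + 1)) :
    circAbs (N0 ℓ Mh k P μ) (twrap (N0 ℓ Mh k P) (z + v) μ - a μ) ≤ circAbs (N0 ℓ Mh k P μ) (z μ - a μ) + |v μ| := by
  unfold twrap
  rw [Pi.add_apply]
  exact circAbs_emod_add_sub_le (one_le_N0 hMh hP μ) _ _ _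

/-- ★★ **THE 2-STEP STENCIL OF A SITE OF `C₁(□)` LIES IN `Ω₀(□)`**: if `z ∈ C₁(□)` then every `w` whose coordinates are within `2` of those of `z` (torus
distance) lies in `Ω₀(□)`. [cite: Balaban1985BackgroundPropagators, p.408 («dist(Ω_n(□)ᶜ, Ω_{n+1}(□)) = 2R₀M₀Lⁿη», «Ω₀(□) ⊂ □⁵»)] -/
theorem stencil2_mem_dirDomC (hL : Odd (ℓ + 1) ∧ 1 < ℓ + 1) (hM : Odd Mh) (hMh : 1 ≤ Mh) (hP : ∀ μ, 1 ≤ P μ) (q : ↥(cubes D.toDomains))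
    {z w : ↥(boxDom (N0 ℓ Mh k P))} (hz : InC q 1 z.1) (hw : ∀ μ, circAbs (N0 ℓ Mh k P μ) (w.1 μ - z.1 μ) ≤ 2) : w ∈ dirDomC D q hMh hP := by
  refine mem_dirDomC_of_near_InC hL.1 hM hMh hP q (m := 2) (by have := three_le_sTop hL hMh (kTop q); omega) fun μ => ?_
  have hN := one_le_N0 (ℓ := ℓ) (k := k) hMh hP μ
  -- `w − c = (z − c) + (w − z)`, and `circAbs(w − z) ≤ 2` realised by the centred representative
  have e : w.1 μ - ctrC q μ = (z.1 μ - ctrC q μ) + (w.1 μ - z.1 μ + (N0 ℓ Mh k P μ : ℤ) * centre (N0 ℓ Mh k P μ) (w.1 μ - z.1 μ)) +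
      (N0 ℓ Mh k P μ : ℤ) * (-centre (N0 ℓ Mh k P μ) (w.1 μ - z.1 μ)) := by ring
  rw [e, circAbs_add_mul]
  refine (circAbs_add_le hN _ _).trans (add_le_add (hz μ) ?_)
  rw [abs_add_mul_centre hN]; exact hw μ

/-- one lattice step moves every coordinate by at most `1` in torus distance. [cite: Balaban1983RegularityDecay, p.572, bookkeeping] -/
theorem circAbs_tshift_sub_le (hMh : 1 ≤ Mh) (hP : ∀ μ, 1 ≤ P μ) (z : ↥(boxDom (N0 ℓ Mh k P))) (ν μ : Fin (d + 1)) (s : ℤ) (hs : |s| ≤ 1) :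
    circAbs (N0 ℓ Mh k P μ) ((tshift (N0 ℓ Mh k P) (s • unitVec ν) z).1 μ - z.1 μ) ≤ 1 := by
  rw [tshift_val]
  refine (circAbs_twrap_add_sub_le hMh hP z.1 (s • unitVec ν) z.1 μ).trans ?_
  have hN := one_le_N0 (ℓ := ℓ) (k := k) hMh hP μ
  have h0 : circAbs (N0 ℓ Mh k P μ) (z.1 μ - z.1 μ) = 0 :=
    le_antisymm (by rw [sub_self]; exact (circAbs_le_abs hN 0).trans (by simp)) (circAbs_nonneg hN _)
  rw [h0, zero_add, Pi.smul_apply, smul_eq_mul, unitVec, Pi.single_apply]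
  split_ifs
  · rw [mul_one]; exact hs
  · rw [mul_zero, abs_zero]; exact zero_le_one

/-- two lattice steps move every coordinate by at most `2` in torus distance. [cite: Balaban1983RegularityDecay, p.572, bookkeeping] -/
theorem circAbs_tshift_tshift_sub_le (hMh : 1 ≤ Mh) (hP : ∀ μ, 1 ≤ P μ) (z : ↥(boxDom (N0 ℓ Mh k P))) (ν ν' μ : Fin (d + 1)) (s s' : ℤ) (hs : |s| ≤ 1)
    (hs' : |s'| ≤ 1) :
    circAbs (N0 ℓ Mh k P μ) ((tshift (N0 ℓ Mh k P) (s' • unitVec ν') (tshift (N0 ℓ Mh k P) (s • unitVec ν) z)).1 μ - z.1 μ) ≤ 2 := by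
  have hN := one_le_N0 (ℓ := ℓ) (k := k) hMh hP μ
  set z₁ := tshift (N0 ℓ Mh k P) (s • unitVec ν) z
  have h1 := circAbs_tshift_sub_le hMh hP z ν μ s hs
  have e : (tshift (N0 ℓ Mh k P) (s' • unitVec ν') z₁).1 μ - z.1 μ =
      ((z₁.1 μ - z.1 μ) + ((tshift (N0 ℓ Mh k P) (s' • unitVec ν') z₁).1 μ - z₁.1 μ +
        (N0 ℓ Mh k P μ : ℤ) * centre (N0 ℓ Mh k P μ) ((tshift (N0 ℓ Mh k P) (s' • unitVec ν') z₁).1 μ - z₁.1 μ))) +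
      (N0 ℓ Mh k P μ : ℤ) * (-centre (N0 ℓ Mh k P μ) ((tshift (N0 ℓ Mh k P) (s' • unitVec ν') z₁).1 μ - z₁.1 μ)) := by ring
  rw [e, circAbs_add_mul]
  refine (circAbs_add_le hN _ _).trans ?_
  rw [abs_add_mul_centre hN]
  have h2 := circAbs_tshift_sub_le hMh hP z₁ ν' μ s' hs'
  linarith

end Stencil

/-! ## §4  The displayed geometry `hS2` of the road-P4 estimate package, as a theorem -/

section SiteForm

variable {ℓ : ℕ} {hd : 1 ≤ d + 1} {hL : Odd (ℓ + 1) ∧ 1 < ℓ + 1} {b₀ b₁ : ℝ}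

/-- `shiftY i μ z = τ_{e_μ} z`, `(shiftY i μ)⁻¹ z = τ_{−e_μ} z`, with `±1`-multiples of the unit vector. [cite: Balaban1983RegularityDecay, p.572, dictionary] -/
theorem shiftY_eq_tshift (i : KIdx d ℓ hd hL b₀ b₁) (μ : Fin (d + 1)) (z : SiteY i) :
    shiftY i μ z = tshift (toKT i).NB ((1 : ℤ) • unitVec μ) z ∧ (shiftY i μ).symm z = tshift (toKT i).NB ((-1 : ℤ) • unitVec μ) z := by
  constructor
  · rw [one_smul]; rfl
  · rw [neg_one_smul]; exact tshift_symm_apply _ _ _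

/-- ★★ **`hS2` DISCHARGED**: for every site `z` of positive cube level, `z`, its `2(d+1)` neighbours and their neighbours all lie in `Ω₀(□)` — verbatim the displayed
geometry hypothesis of `B9Cor36GpDirExtAtField.gpDir_cube_at_field`, `B9Cor36GpDirEntriesAtField.gpDir_cube_entries_at_field`, `B9Cor36GpDirAtMemberBlocks.gpDir_at_member_blocks`.
[cite: Balaban1985BackgroundPropagators, p.408 («Ω₀(□) ⊃ Ω₁(□)», «dist(Ω_n(□)ᶜ, Ω_{n+1}(□)) = 2R₀M₀Lⁿη»)] -/
theorem hS2_dirDomY (i : KIdx d ℓ hd hL b₀ b₁) (c : ↥(cubes (toKT i).D.toDomains)) (z : SiteY i) (hz : 1 ≤ levCubeY i c z) :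
    z ∈ dirDomY i c ∧ ∀ μ, shiftY i μ z ∈ dirDomY i c ∧ (shiftY i μ).symm z ∈ dirDomY i c ∧
      ∀ ν, shiftY i ν (shiftY i μ z) ∈ dirDomY i c ∧ shiftY i ν ((shiftY i μ).symm z) ∈ dirDomY i c ∧ (shiftY i ν).symm ((shiftY i μ).symm z) ∈ dirDomY i c := by
  have hMh := (toKT i).hMh
  have hP := (toKT i).hP
  have hC : InC c 1 z.1 := by
    by_contra hnot
    have h0 := lev_cubeFam_eq_zero (D := (toKT i).D) (q := c) (hL := hL.1) (hM := oddMh i) (hMh := hMh) (hP := hP) hnot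
    have : levCubeY i c z = 0 := h0
    omega
  have key : ∀ w : SiteY i, (∀ μ, circAbs ((toKT i).NB μ) (w.1 μ - z.1 μ) ≤ 2) → w ∈ dirDomY i c := fun w hw =>
    stencil2_mem_dirDomC hL (oddMh i) hMh hP c hC hw
  have h1 : |(1 : ℤ)| ≤ 1 := by norm_num
  have hm1 : |(-1 : ℤ)| ≤ 1 := by norm_num
  have one : ∀ (ν : Fin (d + 1)) (s : ℤ), |s| ≤ 1 → tshift (toKT i).NB (s • unitVec ν) z ∈ dirDomY i c := fun ν s hs =>
    key _ fun μ => (circAbs_tshift_sub_le hMh hP z ν μ s hs).trans (by norm_num)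
  have two : ∀ (ν ν' : Fin (d + 1)) (s s' : ℤ), |s| ≤ 1 → |s'| ≤ 1 →
      tshift (toKT i).NB (s' • unitVec ν') (tshift (toKT i).NB (s • unitVec ν) z) ∈ dirDomY i c := fun ν ν' s s' hs hs' =>
    key _ fun μ => circAbs_tshift_tshift_sub_le hMh hP z ν ν' μ s s' hs hs'
  refine ⟨key z fun μ => by rw [sub_self]; exact (circAbs_le_abs (one_le_N0 hMh hP μ) 0).trans (by norm_num), fun μ => ⟨?_, ?_, fun ν => ⟨?_, ?_, ?_⟩⟩⟩
  · rw [(shiftY_eq_tshift i μ z).1]; exact one μ 1 h1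
  · rw [(shiftY_eq_tshift i μ z).2]; exact one μ (-1) hm1
  · rw [(shiftY_eq_tshift i ν _).1, (shiftY_eq_tshift i μ z).1]; exact two μ ν 1 1 h1 h1
  · rw [(shiftY_eq_tshift i ν _).1, (shiftY_eq_tshift i μ z).2]; exact two μ ν (-1) 1 hm1 h1
  · rw [(shiftY_eq_tshift i ν _).2, (shiftY_eq_tshift i μ z).2]; exact two μ ν (-1) (-1) hm1 hm1

end SiteForm

/-! ## §5  (v1.1) The extent of `Ω₀(□)`: in a mirrored direction every site of `Ω₀(□)` is within `w₁ + 3S_{k′} + 1` of the centre (the box a (3.35) datum must cover) -/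

section Extent

variable {ℓ Mh k R : ℕ} {P : Fin (d + 1) → ℕ} {D : B6MultiLevelTorusOperator.TDomains d ℓ Mh k P R}

/-- `n_μ ≤ 2w₁ + 1 + 4S_{k′}`. [cite: Balaban1983RegularityDecay, (2.42) p.584, bookkeeping] -/
theorem nMir_le (hMh : 1 ≤ Mh) (q : ↥(cubes D.toDomains)) (μ : Fin (d + 1)) :
    nMir ℓ Mh (kTop q) (mC q) μ ≤ 2 * wid ℓ Mh R q.1.1 1 + 1 + 4 * sTop ℓ Mh (kTop q) := by
  rw [B9CubeSequence408Mirrors.nMir_mC hMh]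
  have hs := one_le_sTop (ℓ := ℓ) (k' := kTop q) hMh
  have h1 := Int.ediv_mul_le (2 * wid ℓ Mh R q.1.1 1 + 1) (show sTop ℓ Mh (kTop q) ≠ 0 by omega)
  linarith

/-- ★ **THE EXTENT OF `Ω₀(□)`**: in a MIRRORED direction `μ` every site of `Ω₀(□)` satisfies `circAbs_{N₀}(z_μ − c_μ) ≤ w₁ + 3S_{k′} + 1` — so a (3.35) datum box for
road P4 must cover, around the centre of `□`, half-width `w₁ + 3S_{k′} + 1` in every mirrored direction (and the whole circle in a wrapping one, where
`2w₁ + 1 + 5S_{k′} > N₀_μ`).  The located size of this seat's LOCATED-32. [cite: Balaban1985BackgroundPropagators, p.408 («Ω₀(□) ⊂ □⁵»), (3.35) p.396 («□ … of the class»); Balaban1983RegularityDecay, (2.42) p.584] -/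
theorem circAbs_le_of_mem_dirDomC (hMh : 1 ≤ Mh) (hP : ∀ μ, 1 ≤ P μ) (q : ↥(cubes D.toDomains)) {z : ↥(boxDom (N0 ℓ Mh k P))}
    (hz : z ∈ dirDomC D q hMh hP) {μ : Fin (d + 1)} (hμ : mirC q μ = true) :
    circAbs (N0 ℓ Mh k P μ) (z.1 μ - ctrC q μ) ≤ wid ℓ Mh R q.1.1 1 + 3 * sTop ℓ Mh (kTop q) + 1 := by
  rw [mem_dirDomC_iff] at hz
  obtain ⟨y, hy, he⟩ := hz
  have hN := one_le_N0 (ℓ := ℓ) (k := k) hMh hP μ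
  obtain ⟨hG1, hG2⟩ := gC_window (ℓ := ℓ) (R := R) hMh hμ
  have hn := nMir_le (ℓ := ℓ) (R := R) hMh q μ
  have hy' := hy
  simp only [boxC, mirBoxOpen, Finset.mem_filter, Finset.mem_univ, true_and] at hy'
  obtain ⟨h1, h2⟩ := hy' μ hμ
  -- `z_μ = (y_μ + g_μ) mod N₀`, so `z_μ − c_μ ≡ (y_μ + g_μ − c_μ)` and the latter is within the stated window
  have hzμ : z.1 μ = (y.1 μ + gC q μ) % (N0 ℓ Mh k P μ : ℤ) := by
    have := congrFun he μ
    exact this.symm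
  have e : z.1 μ - ctrC q μ = (y.1 μ + gC q μ - ctrC q μ) + (N0 ℓ Mh k P μ : ℤ) * (-((y.1 μ + gC q μ) / (N0 ℓ Mh k P μ : ℤ))) := by
    rw [hzμ, Int.emod_def]; ring
  rw [e, circAbs_add_mul]
  refine (circAbs_le_abs hN _).trans (abs_le.2 ⟨by linarith, by linarith⟩)

/-- in a WRAPPING direction (`mirC q μ = false`) the member torus is short: `N₀_μ < 2w₁ + 1 + 5S_{k′}`, and `Ω₀(□)` is unconstrained there (the datum box is the circle).
[cite: Balaban1985BackgroundPropagators, p.408, bookkeeping] -/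
theorem N0_lt_of_not_mirC (q : ↥(cubes D.toDomains)) {μ : Fin (d + 1)} (hμ : ¬ mirC q μ = true) :
    (N0 ℓ Mh k P μ : ℤ) < 2 * wid ℓ Mh R q.1.1 1 + 1 + 5 * sTop ℓ Mh (kTop q) := by
  unfold mirC at hμ
  rw [decide_eq_true_eq] at hμ
  linarith

/-- ★ **THE DATUM-BOX INTERFACE**: a set `Q` of V1 sites containing every site whose box-chart coordinates are within `w₁ + 3S_{k′} + 1` of the centre of `□` in the
mirrored directions (no condition in the wrapping ones) contains the chart preimage of `Ω₀(□)` — the hypothesis `hQ` of `B9Cor36GpDirExtAtField.gpDir_cube_at_field` ∕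
`B9Cor36GpDirAtMemberBlocks.gpDir_at_member_blocks` from a BOX-shaped (3.35) datum. [cite: Balaban1985BackgroundPropagators, (3.35) p.396 («□ … of the class described in this condition»), p.408 («Ω₀(□) ⊂ □⁵»)] -/
theorem hQ_of_box {hd : 1 ≤ d + 1} {hL : Odd (ℓ + 1) ∧ 1 < ℓ + 1} {b₀ b₁ : ℝ} (i : KIdx d ℓ hd hL b₀ b₁) (c : ↥(cubes (toKT i).D.toDomains)) {Q : Set (Site (B6GlobalChartV1.PV d ℓ i.m i.K hd hL) 0)}
    (hQ : ∀ x, (∀ μ, mirC c μ = true → circAbs ((toKT i).NB μ) ((B6GlobalChartV1.boxEquiv i.hN x).1 μ - ctrC c μ) ≤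
      wid ℓ (toKT i).Mh (toKT i).R c.1.1 1 + 3 * sTop ℓ (toKT i).Mh (kTop c) + 1) → x ∈ Q) :
    ∀ z ∈ dirDomY i c, (B6GlobalChartV1.boxEquiv i.hN).symm z ∈ Q := fun z hz =>
  hQ _ fun μ hμ => by
    rw [Equiv.apply_symm_apply]
    exact circAbs_le_of_mem_dirDomC (toKT i).hMh (toKT i).hP c hz hμ

end Extent

end

end Literature.MathematicalPhysics.QuantumFieldTheory.Balaban1983to89.B9CubeSequence408MirrorsStencil
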